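import Mathlib.Analysis.Distribution.SchwartzSpace.Fourier
import Mathlib.Analysis.SpecialFunctions.SmoothTransition
import Mathlib.Analysis.Fourier.FourierTransformDeriv
import Mathlib.Analysis.Calculus.IteratedDeriv.Lemmas
import Mathlib.Analysis.Calculus.Deriv.Support
import HarnessLib

/-!
# Radziwiłł 2012, Proposition A: the test function `f` of §3

Sibling of `MollifierLimitationsPropAInputs.lean` (independent of it). The proof of Proposition A (§3 of
M. Radziwiłł, *Limitations to mollifying `ζ(s)`*, arXiv:1207.6583) chooses "a function `f`
supported on the interval `0 ≤ 2πx ≤ log(T^{1+η}·N) + 1`, equal to one in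
`1 ≤ 2πx ≤ log(T^{1+η}·N)` and bounded between `0` and `1`, with `f^{(ℓ)}(x) ≪_ℓ 1` for any
given `ℓ > 0`" and uses "for any fixed `v`, `f̂(x) ≪ (log T) · (1 + |x| log T)^{-v}`" (p. 7). Since
Lemma 1 is applied to the Dirichlet polynomial `1 − B(s)`, whose constant term has frequency
`log 1 = 0`, the plateau must contain `x = 0`; we therefore use the plateau `[0, L]` with
transition layers of width `1/2π` on *both* sides (support `[−1/2π, L + 1/2π]`), which changes
only the `O(1)` in the length of the support (absorbed by `η log T` in §3).

## Construction and results (all proved)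

* `riseFn x = smoothTransition(2πx + 1)` (as a complex number): smooth, monotone, `= 0` for
  `x ≤ −1/2π`, `= 1` for `x ≥ 0`; its derivatives of order `k ≥ 1` are continuous and supported
  in `[−1/2π, 0]`, with `L¹` norms `riseNorm k`.
* `plateauFn L x = riseFn x − riseFn (x − L − 1/2π)`: for `L ≥ 0` it is `1` on `[0, L]`, `0` off
  `[−1/2π, L + 1/2π]`, takes values in `[0, 1]`, is smooth with compact support
  (`plateauSchwartz L hL : 𝓢(ℝ, ℂ)`), and — the point — `‖(plateauFn L)^{(k)}‖_{L¹} ≤ 2 riseNorm k`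
  *uniformly in `L`* (`integral_norm_iteratedDeriv_plateauFn_le`).
* Fourier decay, uniform in `L`: `‖𝓕⁻ f (x)‖ ≤ L + 1/π` and, for `k ≥ 1` and `x ≠ 0`,
  `‖𝓕⁻ f (x)‖ ≤ 2 riseNorm k / (2π|x|)^k` (`norm_fourierInv_plateau_le_length`,
  `norm_fourierInv_plateau_le_div_pow`), from `𝓕(f^{(k)})(x) = (2πix)^k 𝓕f(x)` (Mathlib).

## References

* [Radziwill2012] M. Radziwiłł, *Limitations to mollifying ζ(s)*, arXiv:1207.6583, §3 (p. 7).
-/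

noncomputable section

open Complex MeasureTheory Real Set SchwartzMap Filter Topology
open scoped FourierTransform ContDiff

namespace Literature.Barriers.RiemannHypothesis

/-! ## The rise function -/

/-- The smooth rise `ρ(x) = smoothTransition(2πx + 1)`, viewed in `ℂ`: `0` for `x ≤ −1/2π`,
`1` for `x ≥ 0`, monotone in between. [folklore] -/
def riseFn (x : ℝ) : ℂ := ((Real.smoothTransition (2 * π * x + 1) : ℝ) : ℂ)

/-- `ρ` is smooth. [folklore] -/
theorem contDiff_riseFn {N : ℕ∞} : ContDiff ℝ N riseFn := by
  unfold riseFn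
  apply Complex.ofRealCLM.contDiff.comp
  exact Real.smoothTransition.contDiff.comp (by fun_prop)

/-- `ρ(x) = 1` for `x ≥ 0`. [folklore] -/
theorem riseFn_eq_one {x : ℝ} (hx : 0 ≤ x) : riseFn x = 1 := by
  unfold riseFn
  have h : 0 ≤ 2 * π * x := by positivity
  rw [Real.smoothTransition.one_of_one_le (by linarith)]
  simp

/-- `ρ(x) = 0` for `x ≤ −1/2π`. [folklore] -/
theorem riseFn_eq_zero {x : ℝ} (hx : x ≤ -(1 / (2 * π))) : riseFn x = 0 := by
  unfold riseFn
  have h : 2 * π * x + 1 ≤ 0 := by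
    have hπ : 0 < 2 * π := by positivity
    have : 2 * π * x ≤ 2 * π * (-(1 / (2 * π))) := by gcongr
    have h2 : 2 * π * (-(1 / (2 * π))) = -1 := by field_simp
    linarith
  rw [Real.smoothTransition.zero_of_nonpos h]
  simp

/-- `ρ` is real with `0 ≤ ρ(y) ≤ ρ(x) ≤ 1` for `y ≤ x`; in particular `‖ρ(x) − ρ(y)‖ ≤ 1`.
[folklore] -/
theorem norm_riseFn_sub_le {x y : ℝ} (hxy : y ≤ x) : ‖riseFn x - riseFn y‖ ≤ 1 := by
  unfold riseFn
  rw [← Complex.ofReal_sub, Complex.norm_real, Real.norm_eq_abs, abs_le]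
  have hmono : Real.smoothTransition (2 * π * y + 1) ≤ Real.smoothTransition (2 * π * x + 1) :=
    Real.smoothTransition.monotone (by nlinarith [Real.pi_pos])
  have h0 := Real.smoothTransition.nonneg (2 * π * y + 1)
  have h1 := Real.smoothTransition.le_one (2 * π * x + 1)
  constructor <;> linarith

/-- For `k ≥ 1`, the `k`-th derivative of `ρ` vanishes off `[−1/2π, 0]` (where `ρ` is locally
constant). [folklore] -/
theorem iteratedDeriv_riseFn_eq_zero {k : ℕ} (hk : 1 ≤ k) {x : ℝ}
    (hx : x ∉ Icc (-(1 / (2 * π))) 0) : iteratedDeriv k riseFn x = 0 := by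
  have hk0 : k ≠ 0 := by omega
  have h0mem : (0 : ℝ) ∈ Icc (-(1 / (2 * π))) 0 := ⟨by rw [neg_nonpos]; positivity, le_rfl⟩
  have hx0 : x ≠ 0 := fun h ↦ hx (h ▸ h0mem)
  rcases lt_or_gt_of_ne hx0 with hneg | hpos
  · -- `x < 0`; since `x ∉ [−1/2π, 0]`, in fact `x < −1/2π`
    have hx' : x < -(1 / (2 * π)) := by
      by_contra h
      exact hx ⟨le_of_not_gt h, hneg.le⟩
    have hev : riseFn =ᶠ[𝓝 x] fun _ ↦ (0 : ℂ) := by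
      filter_upwards [Iio_mem_nhds hx'] with y hy
      exact riseFn_eq_zero (le_of_lt hy)
    rw [hev.iteratedDeriv_eq k, iteratedDeriv_const, if_neg hk0]
  · have hev : riseFn =ᶠ[𝓝 x] fun _ ↦ (1 : ℂ) := by
      filter_upwards [Ioi_mem_nhds hpos] with y hy
      exact riseFn_eq_one (le_of_lt hy)
    rw [hev.iteratedDeriv_eq k, iteratedDeriv_const, if_neg hk0]

/-- For `k ≥ 1`, `ρ^{(k)}` is continuous with compact support, hence integrable. [folklore] -/
theorem integrable_iteratedDeriv_riseFn {k : ℕ} (hk : 1 ≤ k) :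
    Integrable (iteratedDeriv k riseFn) := by
  apply Continuous.integrable_of_hasCompactSupport
  · exact contDiff_riseFn.continuous_iteratedDeriv k (by exact_mod_cast le_top)
  · apply HasCompactSupport.of_support_subset_isCompact (isCompact_Icc (a := -(1 / (2 * π)))
      (b := 0))
    intro x hx
    by_contra h
    exact hx (iteratedDeriv_riseFn_eq_zero hk h)

/-- `riseNorm k = ‖ρ^{(k)}‖_{L¹}`, the constant governing the Fourier decay of the plateau
functions (finite for `k ≥ 1`). [folklore] -/
def riseNorm (k : ℕ) : ℝ := ∫ x : ℝ, ‖iteratedDeriv k riseFn x‖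

/-- `0 ≤ riseNorm k`. [folklore] -/
theorem riseNorm_nonneg (k : ℕ) : 0 ≤ riseNorm k :=
  integral_nonneg fun _ ↦ norm_nonneg _

/-! ## The plateau function -/

/-- The plateau `f_L(x) = ρ(x) − ρ(x − L − 1/2π)`: equal to `1` on `[0, L]`, supported in
`[−1/2π, L + 1/2π]`. [cite: Radziwill2012, §3] -/
def plateauFn (L : ℝ) (x : ℝ) : ℂ := riseFn x - riseFn (x - (L + 1 / (2 * π)))

/-- `f_L` is smooth. [folklore] -/
theorem contDiff_plateauFn (L : ℝ) {N : ℕ∞} : ContDiff ℝ N (plateauFn L) := by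
  unfold plateauFn
  exact contDiff_riseFn.sub (contDiff_riseFn.comp (contDiff_id.sub contDiff_const))

/-- `f_L = 1` on `[0, L]`. [cite: Radziwill2012, §3] -/
theorem plateauFn_eq_one {L x : ℝ} (hx : x ∈ Icc 0 L) : plateauFn L x = 1 := by
  unfold plateauFn
  rw [riseFn_eq_one hx.1, riseFn_eq_zero (by have := hx.2; linarith), sub_zero]

/-- `f_L = 0` off `[−1/2π, L + 1/2π]` (for `L ≥ 0`). [cite: Radziwill2012, §3] -/
theorem plateauFn_eq_zero {L x : ℝ} (hL : 0 ≤ L)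
    (hx : x ∉ Icc (-(1 / (2 * π))) (L + 1 / (2 * π))) : plateauFn L x = 0 := by
  unfold plateauFn
  have hπ : 0 < 1 / (2 * π) := by positivity
  rcases lt_or_ge x (-(1 / (2 * π))) with h | h
  · rw [riseFn_eq_zero h.le, riseFn_eq_zero (by linarith), sub_zero]
  · have h2 : L + 1 / (2 * π) < x := by
      by_contra h2
      exact hx ⟨h, le_of_not_gt h2⟩
    rw [riseFn_eq_one (by linarith), riseFn_eq_one (by linarith), sub_self]

/-- `‖f_L(x)‖ ≤ 1`. [cite: Radziwill2012, §3] -/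
theorem norm_plateauFn_le (L x : ℝ) (hL : 0 ≤ L) : ‖plateauFn L x‖ ≤ 1 := by
  apply norm_riseFn_sub_le
  have : 0 < 1 / (2 * π) := by positivity
  linarith

/-- `f_L` has compact support (for `L ≥ 0`). [folklore] -/
theorem hasCompactSupport_plateauFn {L : ℝ} (hL : 0 ≤ L) : HasCompactSupport (plateauFn L) := by
  apply HasCompactSupport.of_support_subset_isCompact
    (isCompact_Icc (a := -(1 / (2 * π))) (b := L + 1 / (2 * π)))
  intro x hx
  by_contra h
  exact hx (plateauFn_eq_zero hL h)

/-- `f_L` as a Schwartz function. [folklore] -/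
def plateauSchwartz (L : ℝ) (hL : 0 ≤ L) : 𝓢(ℝ, ℂ) :=
  (hasCompactSupport_plateauFn hL).toSchwartzMap (contDiff_plateauFn L)

/-- Evaluation of `plateauSchwartz`. [folklore] -/
@[simp] theorem plateauSchwartz_apply (L : ℝ) (hL : 0 ≤ L) (x : ℝ) :
    plateauSchwartz L hL x = plateauFn L x := rfl

/-- The coercion of `plateauSchwartz` is `plateauFn`. [folklore] -/
theorem coe_plateauSchwartz (L : ℝ) (hL : 0 ≤ L) :
    (plateauSchwartz L hL : ℝ → ℂ) = plateauFn L := rfl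

/-- The derivatives of `f_L`: `f_L^{(k)}(x) = ρ^{(k)}(x) − ρ^{(k)}(x − L − 1/2π)`. [folklore] -/
theorem iteratedDeriv_plateauFn (L : ℝ) (k : ℕ) (x : ℝ) :
    iteratedDeriv k (plateauFn L) x =
      iteratedDeriv k riseFn x - iteratedDeriv k riseFn (x - (L + 1 / (2 * π))) := by
  have h1 : plateauFn L = riseFn - fun y ↦ riseFn (y - (L + 1 / (2 * π))) := by
    funext y; rfl
  have h2 : ContDiff ℝ (k : ℕ∞) (fun y : ℝ ↦ riseFn (y - (L + 1 / (2 * π)))) :=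
    (contDiff_riseFn (N := k)).comp (contDiff_id.sub contDiff_const)
  rw [h1, iteratedDeriv_sub (contDiff_riseFn (N := k)).contDiffAt h2.contDiffAt,
    iteratedDeriv_comp_sub_const]

/-- For `k ≥ 1`, `f_L^{(k)}` is integrable. [folklore] -/
theorem integrable_iteratedDeriv_plateauFn (L : ℝ) {k : ℕ} (hk : 1 ≤ k) :
    Integrable (iteratedDeriv k (plateauFn L)) := by
  have h : iteratedDeriv k (plateauFn L) =
      fun x ↦ iteratedDeriv k riseFn x - iteratedDeriv k riseFn (x - (L + 1 / (2 * π))) := by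
    funext x; exact iteratedDeriv_plateauFn L k x
  rw [h]
  exact (integrable_iteratedDeriv_riseFn hk).sub
    ((integrable_iteratedDeriv_riseFn hk).comp_sub_right _)

/-- **The `L¹` norms of the derivatives of `f_L` are bounded uniformly in `L`:**
`∫ ‖f_L^{(k)}‖ ≤ 2 · riseNorm k` for `k ≥ 1` ("`f^{(ℓ)} ≪_ℓ 1`", Radziwiłł §3).
[cite: Radziwill2012, §3] -/
theorem integral_norm_iteratedDeriv_plateauFn_le (L : ℝ) {k : ℕ} (hk : 1 ≤ k) :
    ∫ x : ℝ, ‖iteratedDeriv k (plateauFn L) x‖ ≤ 2 * riseNorm k := by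
  have hint := integrable_iteratedDeriv_riseFn hk
  calc ∫ x : ℝ, ‖iteratedDeriv k (plateauFn L) x‖
      = ∫ x : ℝ, ‖iteratedDeriv k riseFn x - iteratedDeriv k riseFn (x - (L + 1 / (2 * π)))‖ := by
        simp_rw [iteratedDeriv_plateauFn]
    _ ≤ ∫ x : ℝ, (‖iteratedDeriv k riseFn x‖ +
          ‖iteratedDeriv k riseFn (x - (L + 1 / (2 * π)))‖) := by
        apply integral_mono_of_nonneg (Eventually.of_forall fun _ ↦ norm_nonneg _)
          (hint.norm.add (hint.norm.comp_sub_right _)) (Eventually.of_forall fun _ ↦ ?_)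
        exact norm_sub_le _ _
    _ = riseNorm k + riseNorm k := by
        rw [integral_add hint.norm (hint.norm.comp_sub_right _)]
        congr 1
        exact integral_sub_right_eq_self (fun x ↦ ‖iteratedDeriv k riseFn x‖) _
    _ = 2 * riseNorm k := by ring

/-! ## Fourier decay, uniform in `L` -/

/-- `‖𝓕 g (w)‖ ≤ ∫ ‖g‖`. [folklore] -/
theorem norm_fourier_le_integral_norm (g : ℝ → ℂ) (w : ℝ) : ‖𝓕 g w‖ ≤ ∫ v : ℝ, ‖g v‖ := by
  rw [Real.fourier_real_eq_integral_exp_smul]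
  refine (norm_integral_le_integral_norm _).trans (le_of_eq ?_)
  congr 1
  funext v
  rw [norm_smul, Complex.norm_exp_ofReal_mul_I, one_mul]

/-- `‖𝓕⁻ g (w)‖ ≤ ∫ ‖g‖`. [folklore] -/
theorem norm_fourierInv_le_integral_norm (g : ℝ → ℂ) (w : ℝ) : ‖𝓕⁻ g w‖ ≤ ∫ v : ℝ, ‖g v‖ := by
  rw [Real.fourierInv_eq_fourier_neg]
  exact norm_fourier_le_integral_norm g (-w)

/-- `∫ ‖f_L‖ ≤ L + 1/π` (`|f_L| ≤ 1` on its support `[−1/2π, L + 1/2π]`). [folklore] -/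
theorem integral_norm_plateauFn_le {L : ℝ} (hL : 0 ≤ L) :
    ∫ x : ℝ, ‖plateauFn L x‖ ≤ L + 1 / π := by
  have hπ : 0 < 1 / (2 * π) := by positivity
  have hab : -(1 / (2 * π)) ≤ L + 1 / (2 * π) := by linarith
  have hind : (fun x ↦ ‖plateauFn L x‖) =
      (Icc (-(1 / (2 * π))) (L + 1 / (2 * π))).indicator fun x ↦ ‖plateauFn L x‖ := by
    funext x
    by_cases hx : x ∈ Icc (-(1 / (2 * π))) (L + 1 / (2 * π))
    · rw [indicator_of_mem hx]
    · rw [indicator_of_notMem hx, plateauFn_eq_zero hL hx, norm_zero]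
  rw [hind, integral_indicator measurableSet_Icc]
  calc ∫ x in Icc (-(1 / (2 * π))) (L + 1 / (2 * π)), ‖plateauFn L x‖
      ≤ ∫ x in Icc (-(1 / (2 * π))) (L + 1 / (2 * π)), (1 : ℝ) := by
        apply setIntegral_mono_on _ (by simp) measurableSet_Icc fun x _ ↦ norm_plateauFn_le L x hL
        exact ((contDiff_plateauFn L (N := ⊤)).continuous.norm.integrableOn_Icc)
    _ = L + 1 / π := by
        rw [setIntegral_const, smul_eq_mul, mul_one, Real.volume_real_Icc_of_le hab]
        field_simp
        ring

/-- **Trivial bound**: `‖𝓕⁻ f_L (x)‖ ≤ L + 1/π`. [folklore] -/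
theorem norm_fourierInv_plateau_le_length {L : ℝ} (hL : 0 ≤ L) (x : ℝ) :
    ‖𝓕⁻ (plateauFn L) x‖ ≤ L + 1 / π :=
  (norm_fourierInv_le_integral_norm _ _).trans (integral_norm_plateauFn_le hL)

/-- **Decay bound, uniform in `L`**: for `k ≥ 1` and `x ≠ 0`,
`‖𝓕⁻ f_L (x)‖ ≤ 2 riseNorm k / (2π|x|)^k` (integration by parts `k` times:
`𝓕(f^{(k)})(x) = (2πix)^k 𝓕 f(x)` and `‖𝓕(f^{(k)})‖_∞ ≤ ‖f^{(k)}‖₁ ≤ 2 riseNorm k`). This is the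
paper's "`f̂(x) ≪_v (1 + |x|)^{-v}` with constants independent of the length of the plateau".
[cite: Radziwill2012, §3] -/
theorem norm_fourierInv_plateau_le_div_pow {L : ℝ} (hL : 0 ≤ L) {k : ℕ} (hk : 1 ≤ k) {x : ℝ}
    (hx : x ≠ 0) : ‖𝓕⁻ (plateauFn L) x‖ ≤ 2 * riseNorm k / (2 * π * |x|) ^ k := by
  have hcd : ContDiff ℝ (k : ℕ∞) (plateauFn L) := contDiff_plateauFn L
  have hint : ∀ n : ℕ, (n : ℕ∞) ≤ (k : ℕ∞) → Integrable (iteratedDeriv n (plateauFn L)) := by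
    intro n _
    rcases Nat.eq_zero_or_pos n with h0 | hpos
    · subst h0
      simp only [iteratedDeriv_zero]
      exact (contDiff_plateauFn L (N := ⊤)).continuous.integrable_of_hasCompactSupport
        (hasCompactSupport_plateauFn hL)
    · exact integrable_iteratedDeriv_plateauFn L hpos
  have key := Real.fourier_iteratedDeriv (E := ℂ) hcd hint le_rfl
  -- evaluate at `-x`
  have hkey : 𝓕 (iteratedDeriv k (plateauFn L)) (-x) =
      (2 * π * I * (-x : ℝ)) ^ k • 𝓕 (plateauFn L) (-x) := congrFun key (-x)
  have hnorm : ‖(2 * π * I * (-x : ℝ)) ^ k‖ = (2 * π * |x|) ^ k := by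
    rw [norm_pow]
    congr 1
    push_cast
    simp only [norm_mul, norm_neg, Complex.norm_real, Complex.norm_I, Real.norm_eq_abs,
      Complex.norm_ofNat, mul_one]
    rw [abs_of_pos Real.pi_pos]
  have hpos : 0 < (2 * π * |x|) ^ k := by
    apply pow_pos
    have : 0 < |x| := abs_pos.2 hx
    positivity
  rw [Real.fourierInv_eq_fourier_neg, le_div_iff₀ hpos, mul_comm, ← hnorm, ← norm_smul, ← hkey]
  exact (norm_fourier_le_integral_norm _ _).trans (integral_norm_iteratedDeriv_plateauFn_le L hk)

end Literature.Barriers.RiemannHypothesis
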